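import Mathlib
import HarnessLib
import Summits.HubbardSuperconductivity.HubbardSuperconductivity.Theorems.KLProgrammeKLRegimeSplitEdgeFacts
import Summits.HubbardSuperconductivity.HubbardSuperconductivity.Theorems.KLProgrammeKLRegimeEngineFrameLevelCount

/-!
# Route `KLProgramme` — crux K3, ENGINE child (gen 3 `KLRegimeEngineV11` stmt-HubbardSuperconductivity-19823 / gen-4 twin on `klPredsV12`):
# the PAIR-ENERGY GAP on an admissible frame — `|e_K(p) − e_K(p − Q)| ≤ 7√2·|Q|_𝕋` for EVERY `FrameOK` frame, hence
# `≤ Λ_n/2` DEEP INSIDE the pair class (`klEdgeKappa·|Q|_𝕋 ≤ Λ_n`) — the one geometric input of (E2-v8)'s negative-mass edge clause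
# (cell gate-hubbard-kl, seat p1 g7 = clause author)

Plan g11 (HOME/STATUS 22:49:06Z): the engine route of record for the (neg) conjunct of `PairLadderStepAtV8` (`…SplitBundleV12`, Δ21) is
TERMWISE POSITIVITY of the true slice pair weights deep inside the class (`…SplitEdgeFacts`: `kled_negMass_clause` ← `kled_pairWeight_re_nonneg_of_slice`
needs `|e₁ − e₂| ≤ Λ_n/2`), «whose ONLY certified input is the GRADIENT Lipschitz constant of `e_K` on FrameOK frames».  This file proves that
input on the carrier's torus, for every admissible frame:
* §1 `kled_norm_fderiv_frameLevel_le` (`FrameOK` (i) = `GeomConstants (frameLevel μ K) 7 …` ⇒ `‖D e_K‖ ≤ 7` everywhere), `kled_abs_frameLevel_sub_le`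
  (`|e_K(x) − e_K(y)| ≤ 7·‖x − y‖₂`, mean value on `ℝ²`), `kled_frameLevel_periodic` (`(2πℤ)²`-periodicity);
* §2 the torus dictionary: `kled_latticeMomentum_sub` (`p(k − Q)_i ≡ p(k)_i − p(Q)_i mod 2π`), `kled_abs_toIocMod_le_klTorusNorm`;
* §3 **`kled_abs_nambuXiCT_sub_le_of_frameOK`**: `FrameOK R U N μ K → |nambuXiCT L μ K k − nambuXiCT L μ K (k − Q)| ≤ 7·√2·klTorusNorm L Q`, the
  partner form `… (Q − k)` (`nambuXiCT_neg`), and **`kled_gap_deep_of_frameOK`**: `klEdgeKappa·klTorusNorm L Q ≤ Λ ⇒ |e_K(k) − e_K(Q − k)| ≤ Λ/2`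
  (via `kled_gap_of_gradient`: `7√2 < 10 ≤ 64/2`).
Everything is proved; no definition, no named fact; nothing about the effective action is asserted.
-/

noncomputable section

namespace Summit.HubbardSuperconductivity.HubbardSuperconductivity.Theorems.KLRegimeSplit

set_option linter.dupNamespace false -- summit = problem name (single-conjunct summit), D-0017

open Real Finset Literature.MathematicalPhysics.QuantumLattice Literature.Probability.LatticeModels
open Literature.MathematicalPhysics.QuantumLattice.FermiRG
open Summit.HubbardSuperconductivity.HubbardSuperconductivity.Theorems.DispersionFlow
open Summit.HubbardSuperconductivity.HubbardSuperconductivity.Theorems.KLProgrammeLegKernels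

/-! ## §1 The frame band on `ℝ²`: gradient bound, mean value, periodicity -/

section Continuum

variable {μ : ℝ} {K : TrigPolyC4v}

/-- `FrameOK` (i)'s geometric constants give `‖D e_K(x)‖ ≤ 7` at every real momentum. -/
theorem kled_norm_fderiv_frameLevel_le (hG : GeomConstants (frameLevel μ K) 7 (3 / 80) (1 / 2) (3 / 200)) (x : Momentum) :
    ‖fderiv ℝ (frameLevel μ K) x‖ ≤ 7 := by
  rw [← norm_iteratedFDeriv_zero (𝕜 := ℝ) (f := fderiv ℝ (frameLevel μ K)), norm_iteratedFDeriv_fderiv]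
  exact hG.norm_iteratedFDeriv_le x 1 (by norm_num)

/-- **Mean value**: `|e_K(x) − e_K(y)| ≤ 7·‖x − y‖` (Euclidean norm on `ℝ²`). -/
theorem kled_abs_frameLevel_sub_le (hG : GeomConstants (frameLevel μ K) 7 (3 / 80) (1 / 2) (3 / 200)) (x y : Momentum) :
    |frameLevel μ K x - frameLevel μ K y| ≤ 7 * ‖x - y‖ := by
  have hdiff : ∀ z ∈ (Set.univ : Set Momentum), DifferentiableAt ℝ (frameLevel μ K) z := fun z _ =>
    ((EngineV8.contDiff_frameLevel μ K (n := 1)).differentiable (by norm_num)) z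
  have h := Convex.norm_image_sub_le_of_norm_fderiv_le (f := frameLevel μ K) (s := Set.univ) hdiff
    (fun z _ => kled_norm_fderiv_frameLevel_le hG z) convex_univ (Set.mem_univ y) (Set.mem_univ x)
  rwa [Real.norm_eq_abs] at h

/-- **`(2πℤ)²`-periodicity of the frame band** on `ℝ²`. -/
theorem kled_frameLevel_periodic (μ : ℝ) (K : TrigPolyC4v) (u : Fin 2 → ℝ) (z : Fin 2 → ℤ) :
    frameLevel μ K (WithLp.toLp 2 fun i => u i + z i * (2 * Real.pi)) = frameLevel μ K (WithLp.toLp 2 u) := by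
  have hcos : ∀ i, Real.cos (u i + z i * (2 * Real.pi)) = Real.cos (u i) := fun i => Real.cos_add_int_mul_two_pi (u i) (z i)
  simp only [frameLevel, squareDispersion, hcos, TrigPolyC4v.eval_periodic]

end Continuum

/-! ## §2 The torus dictionary -/

section Torus

variable {L : ℕ} [NeZero L]

/-- **Lattice momenta of a difference**: `p(k − Q)_i = p(k)_i − p(Q)_i + m·2π` for an integer `m` (the representatives `val ∈ [0, L)` differ
by a multiple of `L`). -/
theorem kled_latticeMomentum_sub (k Q : TorusSite 2 L) (i : Fin 2) :
    ∃ m : ℤ, latticeMomentum L (k - Q) i = latticeMomentum L k i - latticeMomentum L Q i + m * (2 * Real.pi) := by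
  have hL : (L : ℝ) ≠ 0 := by exact_mod_cast NeZero.ne L
  -- `L ∣ (k i − Q i).val − (k i).val + (Q i).val` as integers
  have hdvd : (L : ℤ) ∣ (((k - Q) i).val : ℤ) - (((k i).val : ℤ) - ((Q i).val : ℤ)) := by
    rw [← ZMod.intCast_eq_intCast_iff_dvd_sub]
    push_cast
    rw [ZMod.natCast_zmod_val, ZMod.natCast_zmod_val, ZMod.natCast_zmod_val, Pi.sub_apply]
  obtain ⟨m, hm⟩ := hdvd
  refine ⟨m, ?_⟩
  have hm' : ((((k - Q) i).val : ℕ) : ℝ) = ((k i).val : ℝ) - ((Q i).val : ℝ) + (m : ℝ) * L := by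
    have := congrArg (fun t : ℤ => (t : ℝ)) hm
    push_cast at this
    linarith
  simp only [latticeMomentum]
  rw [hm']
  field_simp

end Torus

/-- Each torus coordinate of `Q` is within `|Q|_𝕋` of `2πℤ`: `|toIocMod 2π (−π) (p(Q)_i)| ≤ klTorusNorm L Q`. -/
theorem kled_abs_toIocMod_le_klTorusNorm {L : ℕ} (Q : TorusSite 2 L) (i : Fin 2) :
    |toIocMod Real.two_pi_pos (-Real.pi) (latticeMomentum L Q i)| ≤ klTorusNorm L Q := by
  unfold klTorusNorm torusSupNorm torusAbs
  fin_cases i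
  · exact le_max_left _ _
  · exact le_max_right _ _

/-! ## §3 The pair-energy gap on the torus for admissible frames -/

section Gap

variable {L : ℕ} [NeZero L] {R : RenConsts} {U : ℝ} {N : ℕ} {μ : ℝ} {K : TrigPolyC4v}

/-- **The pair-energy gap on an admissible frame**: `|e_K(k) − e_K(k − Q)| ≤ 7·√2·|Q|_𝕋` for every `FrameOK` frame, all torus momenta
`k`, `Q` (`|Q|_𝕋 = klTorusNorm L Q`, the sup-distance of `2πQ/L` to `2πℤ²`). -/
theorem kled_abs_nambuXiCT_sub_le_of_frameOK (hK : FrameOK R U N μ K) (k Q : TorusSite 2 L) :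
    |nambuXiCT L μ K k - nambuXiCT L μ K (k - Q)| ≤ 7 * Real.sqrt 2 * klTorusNorm L Q := by
  -- the representative of `Q` in `(−π, π]²`
  set v : Fin 2 → ℝ := fun i => toIocMod Real.two_pi_pos (-Real.pi) (latticeMomentum L Q i) with hv
  have hvn : ∀ i, ∃ n : ℤ, v i = latticeMomentum L Q i - n * (2 * Real.pi) := by
    intro i
    refine ⟨toIocDiv Real.two_pi_pos (-Real.pi) (latticeMomentum L Q i), ?_⟩
    have := toIocMod_add_toIocDiv_zsmul Real.two_pi_pos (-Real.pi) (latticeMomentum L Q i)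
    rw [zsmul_eq_mul] at this
    simp only [hv]
    linarith
  choose nQ hnQ using hvn
  choose mQ hmQ using fun i => kled_latticeMomentum_sub k Q i
  -- the two real representatives
  set x : Momentum := WithLp.toLp 2 (latticeMomentum L k) with hx
  set y : Momentum := WithLp.toLp 2 (fun i => latticeMomentum L k i - v i) with hy
  have hxk : nambuXiCT L μ K k = frameLevel μ K x := EngineV8.nambuXiCT_eq_frameLevel L μ K k
  have hyk : nambuXiCT L μ K (k - Q) = frameLevel μ K y := by
    rw [EngineV8.nambuXiCT_eq_frameLevel]
    have hrepr : latticeMomentum L (k - Q) = fun i => (latticeMomentum L k i - v i) + ((mQ i - nQ i : ℤ) : ℝ) * (2 * Real.pi) := by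
      funext i; rw [hmQ i, hnQ i]; push_cast; ring
    have hper := kled_frameLevel_periodic μ K (fun i => latticeMomentum L k i - v i) (fun i => mQ i - nQ i)
    rw [hrepr, hy]
    exact hper
  have hxy : x - y = WithLp.toLp 2 v := by
    rw [hx, hy]; ext i; simp
  have hnorm : ‖x - y‖ ≤ Real.sqrt 2 * klTorusNorm L Q := by
    rw [hxy, EuclideanSpace.norm_eq, Fin.sum_univ_two]
    have h0 : |v 0| ≤ klTorusNorm L Q := kled_abs_toIocMod_le_klTorusNorm Q 0
    have h1 : |v 1| ≤ klTorusNorm L Q := kled_abs_toIocMod_le_klTorusNorm Q 1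
    have hρ : 0 ≤ klTorusNorm L Q := KLProgrammeLegKernels.torusSupNorm_nonneg _
    simp only [Real.norm_eq_abs]
    calc Real.sqrt (|v 0| ^ 2 + |v 1| ^ 2) ≤ Real.sqrt (2 * klTorusNorm L Q ^ 2) := by
          apply Real.sqrt_le_sqrt
          nlinarith [abs_nonneg (v 0), abs_nonneg (v 1)]
      _ = Real.sqrt 2 * klTorusNorm L Q := by
          rw [Real.sqrt_mul (by norm_num), Real.sqrt_sq hρ]
  rw [hxk, hyk]
  calc |frameLevel μ K x - frameLevel μ K y| ≤ 7 * ‖x - y‖ := kled_abs_frameLevel_sub_le hK.1 x y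
    _ ≤ 7 * (Real.sqrt 2 * klTorusNorm L Q) := mul_le_mul_of_nonneg_left hnorm (by norm_num)
    _ = 7 * Real.sqrt 2 * klTorusNorm L Q := by ring

/-- **Partner form** (the pair `(k, Q − k)`): `|e_K(k) − e_K(Q − k)| ≤ 7·√2·|Q|_𝕋` (`e_K` is even: `nambuXiCT_neg`). -/
theorem kled_abs_nambuXiCT_sub_partner_le_of_frameOK (hK : FrameOK R U N μ K) (k Q : TorusSite 2 L) :
    |nambuXiCT L μ K k - nambuXiCT L μ K (Q - k)| ≤ 7 * Real.sqrt 2 * klTorusNorm L Q := by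
  rw [← neg_sub k Q, nambuXiCT_neg]
  exact kled_abs_nambuXiCT_sub_le_of_frameOK hK k Q

/-- **Deep inside the class the pair-energy gap is below half the scale**: `klEdgeKappa·|Q|_𝕋 ≤ Λ ⇒ |e_K(k) − e_K(Q − k)| ≤ Λ/2` on every
admissible frame — the `hdeep` geometry of `kled_negMass_clause` / `kled_pairWeight_re_nonneg_of_slice`. -/
theorem kled_gap_deep_of_frameOK (hK : FrameOK R U N μ K) (k Q : TorusSite 2 L) {Λ : ℝ}
    (hdeep : klEdgeKappa * klTorusNorm L Q ≤ Λ) : |nambuXiCT L μ K k - nambuXiCT L μ K (Q - k)| ≤ Λ / 2 :=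
  kled_gap_of_gradient (d := Real.sqrt 2 * klTorusNorm L Q)
    (by have := kled_abs_nambuXiCT_sub_partner_le_of_frameOK hK k Q; linarith) le_rfl hdeep

/-- **The termwise positivity input, assembled**: on an admissible frame, deep inside the class (`klEdgeKappa·|Q|_𝕋 ≤ Λ`), a slice pair
weight `a/((iν − e_K(k))(−iν − e_K(Q − k)))` with `a ≥ 0` and the first leg on the slice (`Λ²/4 ≤ ν² + e_K(k)²`) has nonnegative real part. -/
theorem kled_pairWeight_re_nonneg_of_frameOK (hK : FrameOK R U N μ K) (k Q : TorusSite 2 L) {Λ a ν : ℝ} (ha : 0 ≤ a)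
    (hdeep : klEdgeKappa * klTorusNorm L Q ≤ Λ) (h₁ : Λ ^ 2 / 4 ≤ ν ^ 2 + nambuXiCT L μ K k ^ 2) :
    0 ≤ ((a : ℂ) / ((Complex.I * ν - (nambuXiCT L μ K k : ℝ)) * (-Complex.I * ν - (nambuXiCT L μ K (Q - k) : ℝ)))).re :=
  kled_pairWeight_re_nonneg_of_slice ha h₁ (kled_gap_deep_of_frameOK hK k Q hdeep)

end Gap

end Summit.HubbardSuperconductivity.HubbardSuperconductivity.Theorems.KLRegimeSplit

end
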